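import Summits.FinalStateConjecture.FinalStateConjecture.Theses.SwallowTheDatum
import Literature.Geometry.Lorentzian.ModelData
import Literature.Geometry.Lorentzian.NullInfinity
import Literature.Geometry.Lorentzian.Causality

/-!
# Sketch — crux-ideate round 2, ideator 4, crux `KerrShieldedSettles` (stmt-FinalStateConjecture-10054)

First lemmas of the three idea cards (statements only; `sorry` bodies). They must ELABORATE.
-/

noncomputable section

open Literature.Geometry.Lorentzian
open scoped Manifold ContDiff Topology
open Set Filter

namespace Summit.FinalStateConjecture.FinalStateConjecture.Cruxes.KerrShieldedSettles.IdeateR2K4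

/-- The route's hard-coded bent height `T_{M,a}` (verbatim the lambda of items 10052/10054/10055;
definitionally `Disproof.bentHeight`). -/
def routeT (M a : ℝ) : ℝ → ℝ := fun r : ℝ =>
  Real.smoothTransition (r / (4 * M) - 1) *
    (((M) / Real.sqrt ((M) ^ 2 - (a) ^ 2)) *
        (Kerr.rPlus M a * Real.log (r - Kerr.rPlus M a) -
          Kerr.rMinus M a * Real.log (r - Kerr.rMinus M a)) -
      ((M) / Real.sqrt ((M) ^ 2 - (a) ^ 2)) *
        (Kerr.rPlus M a * Real.log ((4 * M) - Kerr.rPlus M a) -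
          Kerr.rMinus M a * Real.log ((4 * M) - Kerr.rMinus M a)))

/-! ## Card A — `killing-flow-transport`: first lemma

The stationary flow `Φ_s (t*, y) = (t* + s, y)` of the Kerr–Schild chart transports the vendored
`t* = 0` sanity fact `kerr_hasCompleteFutureNullInfinity M a (8M)` (ModelData; UNPROVED named fact,
bound as a hypothesis, D-0026) to the BENT slice `t* = T_{M,a}(r)` of the shield: far-region
sojourn completeness of the chart `Kerr.region a r₁` with respect to `(ψ, ν)`. -/
theorem cardA_first_lemma [Kerr.Facts] (M a r₁ : ℝ) (hM : 0 ≤ M) (ha : |a| < M)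
    (hr : Kerr.rMinus M a < r₁) (hr' : r₁ < Kerr.rPlus M a)
    [(Kerr.smoothMetric M a r₁).HasLeviCivita] [(Kerr.smoothMetric M a (8 * M)).HasLeviCivita]
    (hfact : kerr_hasCompleteFutureNullInfinity M a (8 * M))
    (ψ : Kerr.slice a r₁ → Kerr.region a r₁)
    (hψ : ∀ y : Kerr.slice a r₁, (ψ y : E4) =
      E4.ofTimeSpace (routeT M a (Kerr.radius a (E4.ofTimeSpace 0 (y : E3)))) (y : E3))
    (ν : NormalField 𝓘(ℝ, E4) ψ)
    (hsp : (Kerr.smoothMetric M a r₁).IsSpacelikeImmersion 𝓘(ℝ, E3) ψ)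
    (hν : (Kerr.smoothMetric M a r₁).IsFutureUnitNormal 𝓘(ℝ, E3)
      ((Kerr.timeOrientation M a r₁ hM).ofLE le_top) ψ ν) :
    ∃ B₀ : Set (Kerr.slice a r₁), IsCompact B₀ ∧ ∀ s : ℝ, 0 < s → ∃ R₁ : ℝ,
      ∀ p : Kerr.slice a r₁, R₁ < ‖(p : E3)‖ →
        ∀ (γ : ℝ → Kerr.region a r₁) (dom : Set ℝ),
          (Kerr.smoothMetric M a r₁).IsNormalisedNullRayFrom
              ((Kerr.timeOrientation M a r₁ hM).ofLE le_top) ψ ν p γ dom →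
            ¬ BddAbove dom ∨ ENNReal.ofReal s ≤ sojournTime γ dom
              ((Kerr.smoothMetric M a r₁).causalFuture
                ((Kerr.timeOrientation M a r₁ hM).ofLE le_top) (ψ '' B₀)) := by
  sorry

/-! ## Card B — `two-speed-optics-sojourn`: first lemmas

(B1) the INNER cone: Kerr–Schild light is isotropically no slower than `(r − 2M)/(r + 2M)` in
coordinate speed, for every spin `a`; (B2) the Killing energy `E = −g(v, ∂_{t*})` of a future null
vector is pinched between `(1 − 4H) v⁰` and `v⁰`. -/
theorem cardB_first_lemma_innerCone {M a : ℝ} (hM : 0 ≤ M) (x : E4)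
    (hx : 2 * M < Kerr.radius a x) (v : E4) (hv0 : 0 < v 0)
    (hv : (Kerr.radius a x + 2 * M) * E4.spatialNorm v < (Kerr.radius a x - 2 * M) * v 0) :
    Kerr.bilin M a x v v < 0 := by
  sorry

theorem cardB_first_lemma_energyPinch {M a : ℝ} (hM : 0 ≤ M) (x : E4)
    (hx : 0 < Kerr.radius a x) (v : E4) (hv0 : 0 ≤ v 0) (hnull : Kerr.bilin M a x v v = 0) :
    (1 - 4 * Kerr.scalarH M a x) * v 0 ≤ -Kerr.bilin M a x v (E4.basisVector 0) ∧
      -Kerr.bilin M a x v (E4.basisVector 0) ≤ v 0 := by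
  sorry

/-! ## Card C — `tapered-temporal-collar`: first lemma

`W_c := {x ∈ Kerr.region a r₁ | x⁰ − T(r(x)) > −c (r(x) − r₁)}` — the future of the bent slice plus a
past collar whose thickness TAPERS TO ZERO at the inner edge `r = r₁`. For `c` small the slice
`{x⁰ = T(r)}` is a Cauchy hypersurface of the open sub-spacetime `W_c` (met exactly once by every
timelike curve of the chart that lies in `W_c` and has no endpoint in `W_c`). -/
theorem cardC_first_lemma [Kerr.Facts] (M a r₁ : ℝ) (hM : 0 ≤ M) (ha : |a| < M)
    (hr : Kerr.rMinus M a < r₁) (hr' : r₁ < Kerr.rPlus M a) :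
    ∃ c : ℝ, 0 < c ∧
      ∀ (γ : ℝ → Kerr.region a r₁) (s : Set ℝ), s.OrdConnected →
        (Kerr.smoothMetric M a r₁).IsFutureTimelikeCurveOn
            ((Kerr.timeOrientation M a r₁ hM).ofLE le_top) γ s →
        (∀ t ∈ s, -(c * (Kerr.radius a (γ t : E4) - r₁)) <
            (γ t : E4) 0 - routeT M a (Kerr.radius a (γ t : E4))) →
        (∀ q : Kerr.region a r₁, -(c * (Kerr.radius a (q : E4) - r₁)) <
            (q : E4) 0 - routeT M a (Kerr.radius a (q : E4)) →
              ¬ HasFutureEndpoint γ s q ∧ ¬ HasPastEndpoint γ s q) →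
        s.Nonempty →
        ∃! t, t ∈ s ∧ (γ t : E4) 0 = routeT M a (Kerr.radius a (γ t : E4)) := by
  sorry

end Summit.FinalStateConjecture.FinalStateConjecture.Cruxes.KerrShieldedSettles.IdeateR2K4

end
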